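import Summits.AtomisticToContinuum.FouriersLaw.Theorems.PhononMeanFreePathBoundaryKuboSumRule
import Summits.AtomisticToContinuum.FouriersLaw.Theorems.PuiseuxTransferLedgerTwoModeBulkStubProfileSumRuleAux
import Mathlib.MeasureTheory.Integral.IntegralEqImproper

/-!
# The equilibrium sum rule at every site `∫₀^∞ Y_i + ∫₀^∞ X_i = T²/γ`
(stub `stub_profileSumRule` of line `Sketch`, crux stmt-AtomisticToContinuum-12111 `PuiseuxTransferLedger.TwoModeBulk`)

For the pinned anharmonic chain `P = pinnedChain ω₂ lam β γ` (all four `> 0`) with `N + 1` sites `0..N`, `T > 0`,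
a site `i : Fin (N+1)`, Gibbs measure `μ₀ = gibbsMeasure (N+1) T` and CONSTRUCTED kernels
`K_t = transitionKernel (N+1) T T t`, the equilibrium kinetic covariances
`Y_i(t) = μ₀(p_0² · K_t p_i²) - μ₀(p_0²) μ₀(K_t p_i²)` (left contact) and
`X_i(t) = μ₀(p_N² · K_t p_i²) - μ₀(p_N²) μ₀(K_t p_i²)` (right contact) are integrable on `(0, ∞)` and
`∫₀^∞ Y_i + ∫₀^∞ X_i = T²/γ`.

This is the landed `BoundaryKubo.GibbsTtcf.stub_sumRule` (`Theorems/PhononMeanFreePathBoundaryKuboSumRule.lean`,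
the case `i = N`) with the kernel observable `p_N²` replaced by `p_i²`, same proof:
`μ₀(K_t p_i²) = μ₀(p_i²) = μ₀(p_0²) = μ₀(p_N²) = T` (Gibbs invariance of the kernels, Gaussian momenta), so
`Y_i + X_i = μ₀((p_0² + p_N²) · K_t p_i²) - 2T² = -γ⁻¹ μ₀((LH) · K_t p_i²)` with `LH = γ(2T - p_0² - p_N²)` the
generator of the energy; the energy-tested Dynkin identity
`μ₀(H · K_S p_i²) - μ₀(H p_i²) = ∫₀^S μ₀((LH) · K_s p_i²) ds` (`pinnedChain_profileSumRule_gibbs`, helper file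
`…TwoModeBulkStubProfileSumRuleAux`) gives `∫₀^S (Y_i + X_i) = -γ⁻¹ (μ₀(H · K_S p_i²) - μ₀(H p_i²))`; as `S → ∞`,
`μ₀(H · K_S p_i²) → μ₀(H) μ₀(p_i²)` (exponential decay of centred equilibrium correlations,
`pinnedChain_corr_tendsto`), and `Cov_{μ₀}(H, p_i²) = T²` (`IncoherentBounded.integral_kinObs_mul_hamiltonian`).
Integrability of `X_i`, `Y_i`: `pinnedChain_corr_integrableOn`. No definitions.
-/

noncomputable section

open scoped NNReal ENNReal Topology
open MeasureTheory Filter Set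

namespace Summit.AtomisticToContinuum.FouriersLaw.Theorems.TwoModeBulk.Sketch

open Literature.MathematicalPhysics.KineticTheory.HeatConduction
open Literature.MathematicalPhysics.KineticTheory Literature.Probability.Process OscillatorChain
open ProbabilityTheory
open Summit.AtomisticToContinuum.FouriersLaw.Theorems.SubdiffusiveBondHeat
open Summit.AtomisticToContinuum.FouriersLaw.Theorems.IncoherentBounded
open Summit.AtomisticToContinuum.FouriersLaw.Theorems.BoundaryKubo.GibbsTtcf

/-- **STUB `stub_profileSumRule` of line `Sketch` (crux `PuiseuxTransferLedger.TwoModeBulk`): the equilibrium sum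
rule at every site.** For the pinned anharmonic chain with `N + 1` sites (all parameters `> 0`), `T > 0`,
`i : Fin (N+1)`, `μ₀ = gibbsMeasure (N+1) T`, `K_t = transitionKernel (N+1) T T t`:
`Y_i(t) = μ₀(p_0² · K_t p_i²) - μ₀(p_0²) μ₀(K_t p_i²)` and `X_i(t) = μ₀(p_N² · K_t p_i²) - μ₀(p_N²) μ₀(K_t p_i²)`
are integrable on `(0, ∞)` and `∫₀^∞ Y_i + ∫₀^∞ X_i = T²/γ`. Proof: `μ₀(K_t p_i²) = μ₀(p_j²) = T`, so
`Y_i + X_i = -γ⁻¹ μ₀((LH) · K_t p_i²)`, `LH = γ(2T - p_0² - p_N²)`; the energy-tested Dynkin identity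
`μ₀(H · K_S p_i²) - μ₀(H p_i²) = ∫₀^S μ₀((LH) · K_s p_i²) ds` (`pinnedChain_profileSumRule_gibbs`) gives
`∫₀^S (Y_i + X_i) = -γ⁻¹ (μ₀(H · K_S p_i²) - μ₀(H p_i²))`; as `S → ∞` the right side tends to
`-γ⁻¹ (μ₀(H) μ₀(p_i²) - μ₀(H p_i²)) = γ⁻¹ Cov_{μ₀}(H, p_i²) = T²/γ` (Harris decay at the Gibbs state, one Gaussian
integration by parts). Integrability: exponential decay of centred equilibrium correlations. [folklore] -/
theorem stub_profileSumRule :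
    ∀ ω₂ lam β γ : ℝ, 0 < ω₂ → 0 < lam → 0 < β → 0 < γ → ∀ (N : ℕ) (T : ℝ), 0 < T → ∀ i : Fin (N + 1),
      MeasureTheory.IntegrableOn (fun t : ℝ =>
          (∫ z, (z.2 0) ^ 2 * (∫ y, (y.2 i) ^ 2
            ∂((Literature.MathematicalPhysics.KineticTheory.HeatConduction.pinnedChain ω₂ lam β γ).transitionKernel
              (N + 1) T T t.toNNReal z))
            ∂((Literature.MathematicalPhysics.KineticTheory.HeatConduction.pinnedChain ω₂ lam β γ).gibbsMeasure
              (N + 1) T)) -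
          (∫ z, (z.2 0) ^ 2
            ∂((Literature.MathematicalPhysics.KineticTheory.HeatConduction.pinnedChain ω₂ lam β γ).gibbsMeasure
              (N + 1) T)) *
            (∫ z, (∫ y, (y.2 i) ^ 2
              ∂((Literature.MathematicalPhysics.KineticTheory.HeatConduction.pinnedChain ω₂ lam β γ).transitionKernel
                (N + 1) T T t.toNNReal z))
              ∂((Literature.MathematicalPhysics.KineticTheory.HeatConduction.pinnedChain ω₂ lam β γ).gibbsMeasure
                (N + 1) T)))
        (Set.Ioi 0) ∧
      MeasureTheory.IntegrableOn (fun t : ℝ =>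
          (∫ z, (z.2 (Fin.last N)) ^ 2 * (∫ y, (y.2 i) ^ 2
            ∂((Literature.MathematicalPhysics.KineticTheory.HeatConduction.pinnedChain ω₂ lam β γ).transitionKernel
              (N + 1) T T t.toNNReal z))
            ∂((Literature.MathematicalPhysics.KineticTheory.HeatConduction.pinnedChain ω₂ lam β γ).gibbsMeasure
              (N + 1) T)) -
          (∫ z, (z.2 (Fin.last N)) ^ 2
            ∂((Literature.MathematicalPhysics.KineticTheory.HeatConduction.pinnedChain ω₂ lam β γ).gibbsMeasure
              (N + 1) T)) *
            (∫ z, (∫ y, (y.2 i) ^ 2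
              ∂((Literature.MathematicalPhysics.KineticTheory.HeatConduction.pinnedChain ω₂ lam β γ).transitionKernel
                (N + 1) T T t.toNNReal z))
              ∂((Literature.MathematicalPhysics.KineticTheory.HeatConduction.pinnedChain ω₂ lam β γ).gibbsMeasure
                (N + 1) T)))
        (Set.Ioi 0) ∧
      (∫ t in Set.Ioi (0 : ℝ),
          ((∫ z, (z.2 0) ^ 2 * (∫ y, (y.2 i) ^ 2
            ∂((Literature.MathematicalPhysics.KineticTheory.HeatConduction.pinnedChain ω₂ lam β γ).transitionKernel
              (N + 1) T T t.toNNReal z))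
            ∂((Literature.MathematicalPhysics.KineticTheory.HeatConduction.pinnedChain ω₂ lam β γ).gibbsMeasure
              (N + 1) T)) -
          (∫ z, (z.2 0) ^ 2
            ∂((Literature.MathematicalPhysics.KineticTheory.HeatConduction.pinnedChain ω₂ lam β γ).gibbsMeasure
              (N + 1) T)) *
            (∫ z, (∫ y, (y.2 i) ^ 2
              ∂((Literature.MathematicalPhysics.KineticTheory.HeatConduction.pinnedChain ω₂ lam β γ).transitionKernel
                (N + 1) T T t.toNNReal z))
              ∂((Literature.MathematicalPhysics.KineticTheory.HeatConduction.pinnedChain ω₂ lam β γ).gibbsMeasure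
                (N + 1) T)))) +
        (∫ t in Set.Ioi (0 : ℝ),
          ((∫ z, (z.2 (Fin.last N)) ^ 2 * (∫ y, (y.2 i) ^ 2
            ∂((Literature.MathematicalPhysics.KineticTheory.HeatConduction.pinnedChain ω₂ lam β γ).transitionKernel
              (N + 1) T T t.toNNReal z))
            ∂((Literature.MathematicalPhysics.KineticTheory.HeatConduction.pinnedChain ω₂ lam β γ).gibbsMeasure
              (N + 1) T)) -
          (∫ z, (z.2 (Fin.last N)) ^ 2
            ∂((Literature.MathematicalPhysics.KineticTheory.HeatConduction.pinnedChain ω₂ lam β γ).gibbsMeasure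
              (N + 1) T)) *
            (∫ z, (∫ y, (y.2 i) ^ 2
              ∂((Literature.MathematicalPhysics.KineticTheory.HeatConduction.pinnedChain ω₂ lam β γ).transitionKernel
                (N + 1) T T t.toNNReal z))
              ∂((Literature.MathematicalPhysics.KineticTheory.HeatConduction.pinnedChain ω₂ lam β γ).gibbsMeasure
                (N + 1) T)))) = T ^ 2 / γ := by
  -- adapted from `BoundaryKubo.GibbsTtcf.stub_sumRule` (kernel observable `p_N²` ↦ `p_i²`)
  intro ω₂ lam β γ hω hl hβ hγ N T hT i
  -- notation
  set P := pinnedChain ω₂ lam β γ with hPdef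
  have hP : P.IsConfining := pinnedChain_isConfining hω hl.le hβ.le hγ.le
  have hM : 0 < N + 1 := Nat.succ_pos N
  set μ := P.gibbsMeasure (N + 1) T with hμ
  haveI : IsProbabilityMeasure μ := pinnedChain_isProbabilityMeasure_gibbsMeasure hω hl.le hβ.le γ (N + 1) hT
  set K : ℝ≥0 → Kernel (PhaseSpace (N + 1)) (PhaseSpace (N + 1)) := P.transitionKernel (N + 1) T T with hK
  set Hm := P.hamiltonian (N + 1) with hHm
  set A : PhaseSpace (N + 1) → ℝ := fun y => (y.2 i) ^ 2 with hA
  set B : PhaseSpace (N + 1) → ℝ := fun y => (y.2 0) ^ 2 with hB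
  set C : PhaseSpace (N + 1) → ℝ := fun y => (y.2 (Fin.last N)) ^ 2 with hC
  set KA : ℝ → PhaseSpace (N + 1) → ℝ := fun t z => ∫ y, A y ∂(K t.toNNReal z) with hKA
  set Y : ℝ → ℝ := fun t => (∫ z, B z * KA t z ∂μ) - (∫ z, B z ∂μ) * (∫ z, KA t z ∂μ) with hY
  set X : ℝ → ℝ := fun t => (∫ z, C z * KA t z ∂μ) - (∫ z, C z ∂μ) * (∫ z, KA t z ∂μ) with hX
  show IntegrableOn Y (Ioi 0) ∧ IntegrableOn X (Ioi 0) ∧ (∫ t in Ioi (0:ℝ), Y t) + (∫ t in Ioi (0:ℝ), X t) = T ^ 2 / γ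
  -- exponential bounds of `A`, `B`, `C`, `H`, `1` with the exponent `ϑ = 1/(4T)`
  have hϑ0 : (0:ℝ) < 1 / (4 * T) := by positivity
  have h2ϑ : 2 * (1 / (4 * T)) < 1 / T := by
    rw [show 2 * (1 / (4 * T)) = 1 / (2 * T) by field_simp; ring]
    exact one_div_lt_one_div_of_lt hT (by linarith)
  have hϑ1 : 1 / (4 * T) < 1 / T := by linarith
  have hAc : Continuous A := by rw [hA]; fun_prop
  have hBc : Continuous B := by rw [hB]; fun_prop
  have hCc : Continuous C := by rw [hC]; fun_prop
  have hHc : Continuous Hm := pinnedChain_continuous_hamiltonian ω₂ lam β γ (N + 1)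
  have hH0 : ∀ x, 0 ≤ Hm x := fun x => hP.hamiltonian_nonneg (N + 1) x
  have hAb : ∀ y, |A y| ≤ 2 / (1 / (4 * T)) * Real.exp (1 / (4 * T) * Hm y) := fun y =>
    abs_sq_momentum_le_exp hP hϑ0 (N + 1) y _
  have hBb : ∀ y, |B y| ≤ 2 / (1 / (4 * T)) * Real.exp (1 / (4 * T) * Hm y) := fun y =>
    abs_sq_momentum_le_exp hP hϑ0 (N + 1) y _
  have hCb : ∀ y, |C y| ≤ 2 / (1 / (4 * T)) * Real.exp (1 / (4 * T) * Hm y) := fun y =>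
    abs_sq_momentum_le_exp hP hϑ0 (N + 1) y _
  have hHb : ∀ x, |Hm x| ≤ 1 / (1 / (4 * T)) * Real.exp (1 / (4 * T) * Hm x) := fun x => by
    rw [abs_of_nonneg (hH0 x), one_div_mul_eq_div]; exact hamiltonian_le_exp (γ := γ) hϑ0 x
  have h1b : ∀ x : PhaseSpace (N + 1), |(1:ℝ)| ≤ 1 * Real.exp (1 / (4 * T) * Hm x) := fun x => by
    rw [abs_one, one_mul]; exact Real.one_le_exp (mul_nonneg hϑ0.le (hH0 x))
  -- statics: `μ₀(A) = μ₀(B) = μ₀(C) = T`, `μ₀(H A) - μ₀(H) T = T²`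
  have hμA : ∫ z, A z ∂μ = T := integral_momentum_sq_gibbsMeasure hω hl.le hβ hT (N + 1) i
  have hμB : ∫ z, B z ∂μ = T := integral_momentum_sq_gibbsMeasure hω hl.le hβ hT (N + 1) 0
  have hμC : ∫ z, C z ∂μ = T := integral_momentum_sq_gibbsMeasure hω hl.le hβ hT (N + 1) (Fin.last N)
  have hwt1 := pinnedChain_integrable_exp_mul_hamiltonian_gibbsMeasure hω hl.le hβ.le γ (N + 1) hT hϑ1
  have hwt2 := pinnedChain_integrable_exp_mul_hamiltonian_gibbsMeasure hω hl.le hβ.le γ (N + 1) hT h2ϑ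
  have hHint : Integrable Hm μ := integrable_of_abs_le_exp hwt1 hHc hHb
  have hHAint : Integrable (fun z => Hm z * A z) μ :=
    integrable_of_abs_le_exp hwt2 (hHc.mul hAc) (C := 1 / (1 / (4 * T)) * (2 / (1 / (4 * T)))) fun z => by
      rw [abs_mul]
      calc |Hm z| * |A z| ≤ (1 / (1 / (4 * T)) * Real.exp (1 / (4 * T) * Hm z)) *
          (2 / (1 / (4 * T)) * Real.exp (1 / (4 * T) * Hm z)) := mul_le_mul (hHb z) (hAb z) (abs_nonneg _) (by positivity)
        _ = 1 / (1 / (4 * T)) * (2 / (1 / (4 * T))) * Real.exp (2 * (1 / (4 * T)) * Hm z) := by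
          rw [show 2 * (1 / (4 * T)) * Hm z = 1 / (4 * T) * Hm z + 1 / (4 * T) * Hm z by ring, Real.exp_add]; ring
  have hcov : (∫ z, Hm z * A z ∂μ) - (∫ z, Hm z ∂μ) * T = T ^ 2 := by
    have h := integral_kinObs_mul_hamiltonian (γ := γ) hω hl.le hβ.le hT (n := N + 1) i
    have e : ∀ z : PhaseSpace (N + 1), (z.2 i ^ 2 - T) * Hm z = Hm z * A z - T * Hm z := fun z => by
      simp only [hA]; ring
    rw [integral_congr_ae (Eventually.of_forall e), integral_sub hHAint (hHint.const_mul T), integral_const_mul] at h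
    linarith
  -- Gibbs invariance: `μ₀(K_t A) = μ₀(A) = T`
  have hinv : ∀ t : ℝ, ∫ z, KA t z ∂μ = T := fun t => by
    simp only [hKA, hA]; rw [mean_act_sq_momentum hω hl.le hβ hγ hT N i t]; exact hμA
  -- integrability of `B · K_tA`, `C · K_tA`, `K_tA` under `μ₀`
  have hiB : ∀ t : ℝ, Integrable (fun z => B z * KA t z) μ := fun t =>
    integrable_mul_act hω hl.le hβ hγ hT hBc hAc hBb hAb t.toNNReal
  have hiC : ∀ t : ℝ, Integrable (fun z => C z * KA t z) μ := fun t =>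
    integrable_mul_act hω hl.le hβ hγ hT hCc hAc hCb hAb t.toNNReal
  have hi1 : ∀ t : ℝ, Integrable (fun z => KA t z) μ := fun t =>
    (integrable_mul_act hω hl.le hβ hγ hT continuous_const hAc h1b hAb t.toNNReal).congr
      (Eventually.of_forall fun z => one_mul _)
  -- the centred forms of `Y`, `X` and their integrability on `(0, ∞)`
  have hYeq : ∀ t, Y t = (∫ z, B z * KA t z ∂μ) - (∫ z, B z ∂μ) * (∫ z, A z ∂μ) := fun t => by
    simp only [hY]; rw [hinv, hμA]
  have hXeq : ∀ t, X t = (∫ z, C z * KA t z ∂μ) - (∫ z, C z ∂μ) * (∫ z, A z ∂μ) := fun t => by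
    simp only [hX]; rw [hinv, hμA]
  have hYint : IntegrableOn Y (Ioi 0) :=
    (pinnedChain_corr_integrableOn hω hl.le hβ hγ hM hT hBc hAc hBb hAb).congr_fun
      (fun t _ => (hYeq t).symm) measurableSet_Ioi
  have hXint : IntegrableOn X (Ioi 0) :=
    (pinnedChain_corr_integrableOn hω hl.le hβ hγ hM hT hCc hAc hCb hAb).congr_fun
      (fun t _ => (hXeq t).symm) measurableSet_Ioi
  refine ⟨hYint, hXint, ?_⟩
  -- `Y + X = -γ⁻¹ μ₀((LH) · K_t A)` and the energy-tested Dynkin identity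
  have hsum : ∀ t, ∫ z, γ * (2 * T - ((z.2 0) ^ 2 + (z.2 (Fin.last N)) ^ 2)) * KA t z ∂μ = -γ * (Y t + X t) := by
    intro t
    have e : ∀ z : PhaseSpace (N + 1), γ * (2 * T - ((z.2 0) ^ 2 + (z.2 (Fin.last N)) ^ 2)) * KA t z =
        γ * (2 * T * KA t z - (B z * KA t z + C z * KA t z)) := fun z => by simp only [hB, hC]; ring
    have h23 : Integrable (fun z => B z * KA t z + C z * KA t z) μ := (hiB t).add (hiC t)
    rw [integral_congr_ae (Eventually.of_forall e), integral_const_mul, integral_sub ((hi1 t).const_mul _) h23,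
      integral_const_mul, integral_add (hiB t) (hiC t), hinv, hXeq, hYeq, hμA, hμB, hμC]
    ring
  have hfin : ∀ S : ℝ, 0 ≤ S → ∫ t in (0:ℝ)..S, (Y t + X t) =
      -(1 / γ) * ((∫ z, Hm z * KA S z ∂μ) - ∫ z, Hm z * A z ∂μ) := by
    intro S hS
    have h := pinnedChain_profileSumRule_gibbs hω hl.le hβ.le hγ.le N i hT hS
    have e : ∫ t in (0:ℝ)..S, (Y t + X t) = -(1 / γ) * ∫ t in (0:ℝ)..S,
        ∫ z, γ * (2 * T - ((z.2 0) ^ 2 + (z.2 (Fin.last N)) ^ 2)) * KA t z ∂μ := by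
      rw [← intervalIntegral.integral_const_mul]
      refine intervalIntegral.integral_congr fun t _ => ?_
      show Y t + X t = -(1 / γ) * ∫ z, γ * (2 * T - ((z.2 0) ^ 2 + (z.2 (Fin.last N)) ^ 2)) * KA t z ∂μ
      rw [hsum t]; field_simp
    rw [e]
    exact congrArg _ h.symm
  -- the limit `S → ∞`
  have hlimL : Tendsto (fun S => ∫ t in (0:ℝ)..S, (Y t + X t)) atTop (𝓝 (∫ t in Ioi (0:ℝ), (Y t + X t))) :=
    intervalIntegral_tendsto_integral_Ioi 0 (hYint.add hXint) tendsto_id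
  have hlimR : Tendsto (fun S : ℝ => -(1 / γ) * ((∫ z, Hm z * KA S z ∂μ) - ∫ z, Hm z * A z ∂μ)) atTop
      (𝓝 (-(1 / γ) * ((∫ z, Hm z ∂μ) * (∫ z, A z ∂μ) - ∫ z, Hm z * A z ∂μ))) :=
    ((pinnedChain_corr_tendsto hω hl.le hβ hγ hM hT hHc hAc hHb hAb).sub_const _).const_mul _
  have hval : ∫ t in Ioi (0:ℝ), (Y t + X t) = -(1 / γ) * ((∫ z, Hm z ∂μ) * (∫ z, A z ∂μ) - ∫ z, Hm z * A z ∂μ) := by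
    refine tendsto_nhds_unique (hlimL.congr' ?_) hlimR
    filter_upwards [eventually_ge_atTop 0] with S hS
    exact hfin S hS
  rw [← integral_add hYint hXint, hval, hμA]
  have hγ0 : γ ≠ 0 := hγ.ne'
  field_simp
  linarith [hcov]

end Summit.AtomisticToContinuum.FouriersLaw.Theorems.TwoModeBulk.Sketch

end
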